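import Literature.NumberTheory.Automorphic.GLnPlacesSplitting
import Literature.NumberTheory.Automorphic.IntegratedOperatorStar
import HarnessLib

/-!
# `R(ξ_S ⊗ θ) = κ · R_S(ξ_S) ∘ R^S(θ)` along `GL_n(𝔸_K) = G_S × G^S`, and the non-vanishing of
# `R(ξ_S ⊗ θ)` on a representation where `R_S(ξ_S) ≠ 0`, for `θ` concentrated at `1`
(Gelbart, *Automorphic forms on adele groups* (1975), §10, pp. 151–153, (10.12)–(10.13): for
`Φ = (∏_{v ∈ S} f_v) × f` on `G_𝔸 = G_S × G^S`, `R(Φ) = R_S(∏ f_v) ∘ τ(f)`, and the space `M` cut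
out by `R_S(∏ f_v)` meets every constituent with the prescribed components at `S`; Bump (1997),
§3.3, Prop. 3.3.2)

Topic `NumberTheory/Automorphic`; two definitions with bodies (`GLn.placesTestFunction`, the
product test function `g ↦ θ(s_S g) · Ξ(g_S)` on `GL_n(𝔸_K)`, and its bundled form
`GLn.placesTestFunctionCc`) and theorems; no named fact, no instance visible to importers. The
finite-set-of-places version of `GLnPlaceSplittingOperators` (one place), built on the splitting
`GLn.placesSplitting n K S : G_S × G^S ≃ₜ* GL_n(𝔸_K)` and the Haar factorisation
`(splitting⁻¹)_* ν = κ ((⊗_{v ∈ S} μ_v) ⊗ μ')` of `GLnPlacesSplitting`: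

* `GLn.placesTestFunction S Ξ θ (g) = θ(s_S g) Ξ(g_S)` for `Ξ : G_S → ℂ`, `θ : GL_n(𝔸_K) → ℂ`
  (only `θ|_{G^S}` matters); `… (splitting (a, h)) = θ(h) Ξ(a)`; continuous and compactly
  supported when `Ξ`, `θ` are (`supp ⊆ ι_S(supp Ξ) · supp θ`);
* `integratedOperator_eq_smul_integratedOperator_placesSplitting` — `π_ν(Φ) = κ π_P(Φ ∘ splitting)`
  for `π_P = π ∘ splitting` on `P = G_S × G^S` with the measure `(⊗_v μ_v) ⊗ μ'`;
* `integratedOperator_placesTestFunction_eq_smul_comp` — **`π_ν(Ξ ⊗ θ) = κ · π_P|_{G_S}(Ξ) ∘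
  π_P|_{G^S}(θ|_{G^S})`** (`integratedOperator_prod_eq_comp` of `IntegratedOperatorStar`), the two
  factors commuting (`ContRepresentation.integratedOperator_restrict_inl_comm`), and
  `π_P|_{G_S}(Ξ) = (π ∘ ι_S)(Ξ)` (`integratedOperator_restrict_placesSplitting_inl_eq`);
* `GLn.exists_nhds_integratedOperator_placesTestFunction_ne_zero` — **if `(π ∘ ι_S)(Ξ) ≠ 0` then
  there is a neighbourhood `N` of `1` in `GL_n(𝔸_K)` such that `π_ν(Ξ ⊗ θ) ≠ 0` for every
  continuous compactly supported `θ ≥ 0` with `θ(1) > 0` supported in `N`** — the Dirac estimate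
  `exists_nhds_integratedOperator_apply_ne_zero` (`IntegratedOperator`) applied to
  `π|_{G^S}` and a vector `y = (π ∘ ι_S)(Ξ) w ≠ 0`, through `π_ν(Ξ ⊗ θ) w = κ π|_{G^S}(θ) y`.

With `GLn.noncommProd_integratedOperator_toAdelic_ne_zero` (`LocalOperatorsProductNonvanishing`:
`∏_{v ∈ S} (π ∘ ι_v)(ξ_v) ≠ 0` on an irreducible `π` once each factor is non-zero) this is the
non-vanishing, on a cuspidal constituent with prescribed local components at `S`, of Gelbart's test
operators `R(ξ_S ⊗ f)` with the **fixed** ramified factor `ξ_S` — the input `hne` of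
`exists_discreteAutomorphicRep_of_testAlgebra` (`JacquetLanglandsSurjectivePerConstituent`). The
identification `(π ∘ ι_S)(⊗_v ξ_v) = ∏_v (π ∘ ι_v)(ξ_v)` (Fubini on `G_S`) is not part of this
file. Part of the inline (D-0026) decomposition of
`Literature.NumberTheory.Automorphic.jacquetLanglands_transfer_surjective` (Gelbart Thm. 10.5 (ii)).

## References

* S. Gelbart, *Automorphic forms on adele groups*, Ann. of Math. Studies 83 (1975), §10,
  pp. 151–153, (10.12)–(10.13) [Gelbart1975].
* D. Bump, *Automorphic Forms and Representations* (1997), §3.3, Prop. 3.3.2 [Bump1997].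
* A. Deitmar, S. Echterhoff, *Principles of harmonic analysis*, 2nd ed. (2014), Prop. 6.2.1,
  Lemma 6.2.2 [DeitmarEchterhoff2014].
-/

noncomputable section

open MeasureTheory Measure Set Filter Topology IsDedekindDomain NumberField CompactlySupported
open scoped ENNReal NNReal Pointwise

namespace Literature.NumberTheory.Automorphic

section Factors

variable {n : ℕ} {K : Type} [Field K] [NumberField K] {S : Finset (HeightOneSpectrum (𝓞 K))}

/-- On the first factor the splitting is `ι_S`: `splitting (inl a) = ι_S(a)`. [folklore] -/
theorem GLn.placesSplitting_inl' (a : GLn.LocalPi n K S) :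
    GLn.placesSplitting n K S ((MonoidHom.inl _ _) a) = GLn.toAdelicPi n K S a := by
  rw [MonoidHom.inl_apply, GLn.placesSplitting_inl]

/-- On the second factor the splitting is the inclusion: `splitting (inr h) = h`. [folklore] -/
theorem GLn.placesSplitting_inr' (h : GLn.trivialAt n K S) :
    GLn.placesSplitting n K S ((MonoidHom.inr _ _) h) = (h : (AdelicGroupData.gl n K).Adelic) := by
  rw [MonoidHom.inr_apply, GLn.placesSplitting_inr]

variable (S) in
/-- The **product test function** `Φ_{Ξ,θ}(g) = θ(s_S g) · Ξ(g_S)` on `GL_n(𝔸_K)` attached to a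
function `Ξ` on `G_S = ∏_{v ∈ S} GL_n(K_v)` and a weight `θ` on `GL_n(𝔸_K)` (through the part
`s_S(g)` away from `S`; only `θ|_{G^S}` matters) — Gelbart's `Φ = (∏_{v ∈ S} f_v) × f`
(p. 153), i.e. `(Ξ ⊗ θ|_{G^S}) ∘ splitting⁻¹`. [cite: Gelbart1975, §10 p. 153] -/
def GLn.placesTestFunction (Ξ : GLn.LocalPi n K S → ℂ) (θ : (AdelicGroupData.gl n K).Adelic → ℂ)
    (g : (AdelicGroupData.gl n K).Adelic) : ℂ :=
  θ (GLn.awayFromPlaces n K S g) * Ξ (fun v => GLn.toLocalAt n K (v : HeightOneSpectrum (𝓞 K)) g)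

/-- `Φ_{Ξ,θ}(g) = θ(s_S g) Ξ(g_S)` (definitional). [folklore] -/
theorem GLn.placesTestFunction_apply (Ξ : GLn.LocalPi n K S → ℂ)
    (θ : (AdelicGroupData.gl n K).Adelic → ℂ) (g : (AdelicGroupData.gl n K).Adelic) :
    GLn.placesTestFunction S Ξ θ g =
      θ (GLn.awayFromPlaces n K S g) * Ξ (fun v => GLn.toLocalAt n K (v : HeightOneSpectrum (𝓞 K)) g) :=
  rfl

/-- **On the product group the product test function is a pure tensor**:
`Φ_{Ξ,θ}(ι_S(a) h) = θ(h) Ξ(a)` for `h ∈ G^S`. [folklore] -/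
theorem GLn.placesTestFunction_placesSplitting (Ξ : GLn.LocalPi n K S → ℂ)
    (θ : (AdelicGroupData.gl n K).Adelic → ℂ) (p : GLn.LocalPi n K S × GLn.trivialAt n K S) :
    GLn.placesTestFunction S Ξ θ (GLn.placesSplitting n K S p) =
      θ (p.2 : (AdelicGroupData.gl n K).Adelic) * Ξ p.1 := by
  rw [GLn.placesTestFunction_apply, GLn.placesSplitting_apply, GLn.awayFromPlaces_toAdelicPi_mul _ p.2.2]
  congr 1
  congr 1
  funext v
  rw [map_mul, GLn.toLocalAt_toAdelicPi_of_mem v.2, (GLn.mem_trivialAt_iff.1 p.2.2) _ v.2, mul_one]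

/-- `Φ_{Ξ,θ}` is continuous for `Ξ`, `θ` continuous. [folklore] -/
theorem GLn.continuous_placesTestFunction {Ξ : GLn.LocalPi n K S → ℂ} (hΞ : Continuous Ξ)
    {θ : (AdelicGroupData.gl n K).Adelic → ℂ} (hθ : Continuous θ) :
    Continuous (GLn.placesTestFunction S Ξ θ) :=
  (hθ.comp (GLn.continuous_awayFromPlaces n K S)).mul
    (hΞ.comp (continuous_pi fun v : S => GLn.continuous_toLocalAt n K (v : HeightOneSpectrum (𝓞 K))))

/-- `Φ_{Ξ,θ}` has compact support for `Ξ`, `θ` compactly supported: its support lies in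
`ι_S(tsupport Ξ) · tsupport θ` (`g = ι_S(g_S) s_S(g)`). [folklore] -/
theorem GLn.hasCompactSupport_placesTestFunction {Ξ : GLn.LocalPi n K S → ℂ}
    (hΞs : HasCompactSupport Ξ) {θ : (AdelicGroupData.gl n K).Adelic → ℂ}
    (hθs : HasCompactSupport θ) : HasCompactSupport (GLn.placesTestFunction S Ξ θ) := by
  haveI : T2Space (AdelicGroupData.gl n K).Adelic := t2Space_gl n K
  refine HasCompactSupport.intro
    ((hΞs.isCompact.image (GLn.continuous_toAdelicPi n K S)).mul hθs.isCompact) fun g hg => ?_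
  by_contra hne
  have h1 : θ (GLn.awayFromPlaces n K S g) ≠ 0 := fun h =>
    hne (by rw [GLn.placesTestFunction, h, zero_mul])
  have h2 : Ξ (fun v => GLn.toLocalAt n K (v : HeightOneSpectrum (𝓞 K)) g) ≠ 0 := fun h =>
    hne (by rw [GLn.placesTestFunction, h, mul_zero])
  exact hg ⟨_, ⟨_, subset_tsupport _ h2, rfl⟩, GLn.awayFromPlaces n K S g, subset_tsupport _ h1,
    GLn.toAdelicPi_mul_awayFromPlaces g⟩

/-- The product test function as an element of `C_c(GL_n(𝔸_K), ℂ)`. [folklore] -/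
def GLn.placesTestFunctionCc {Ξ : GLn.LocalPi n K S → ℂ} (hΞ : Continuous Ξ) (hΞs : HasCompactSupport Ξ)
    {θ : (AdelicGroupData.gl n K).Adelic → ℂ} (hθ : Continuous θ) (hθs : HasCompactSupport θ) :
    C_c((AdelicGroupData.gl n K).Adelic, ℂ) :=
  ⟨⟨GLn.placesTestFunction S Ξ θ, GLn.continuous_placesTestFunction hΞ hθ⟩,
    GLn.hasCompactSupport_placesTestFunction hΞs hθs⟩

/-- `placesTestFunctionCc … g = Φ_{Ξ,θ}(g)` (definitional). [folklore] -/
@[simp]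
theorem GLn.placesTestFunctionCc_apply {Ξ : GLn.LocalPi n K S → ℂ} (hΞ : Continuous Ξ)
    (hΞs : HasCompactSupport Ξ) {θ : (AdelicGroupData.gl n K).Adelic → ℂ} (hθ : Continuous θ)
    (hθs : HasCompactSupport θ) (g : (AdelicGroupData.gl n K).Adelic) :
    GLn.placesTestFunctionCc hΞ hΞs hθ hθs g = GLn.placesTestFunction S Ξ θ g := rfl

end Factors

/-! ### Integrated operators along the splitting -/

section Operators

variable {n : ℕ} {K : Type} [Field K] [NumberField K] {S : Finset (HeightOneSpectrum (𝓞 K))}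
  {H : Type*} [NormedAddCommGroup H] [InnerProductSpace ℂ H] [CompleteSpace H]

attribute [local instance] adelicBorel borelSpace_adelic locallyCompactSpace_adelic
  secondCountableTopology_gl_adelic

/-- **`π_ν(Φ) = κ · π_P(Φ ∘ splitting)`**: for a unitary strongly continuous representation `π` of
`GL_n(𝔸_K)`, Haar measures `ν`, `μ_v` (`v ∈ S`), `μ'` with `(splitting⁻¹)_* ν = κ ((⊗_v μ_v) ⊗ μ')`
and `Φ`, `Φ_P` compactly supported continuous with `Φ_P = Φ ∘ splitting`, the integrated operator
of `π` with respect to `ν` at `Φ` is `κ` times that of `π_P = π ∘ splitting` with respect to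
`(⊗_v μ_v) ⊗ μ'` at `Φ_P` (change of variables along the splitting). [folklore] -/
theorem integratedOperator_eq_smul_integratedOperator_placesSplitting
    [∀ v : HeightOneSpectrum (𝓞 K), MeasurableSpace (GL (Fin n) (v.adicCompletion K))]
    [∀ v : HeightOneSpectrum (𝓞 K), BorelSpace (GL (Fin n) (v.adicCompletion K))]
    [∀ v : HeightOneSpectrum (𝓞 K), SecondCountableTopology (GL (Fin n) (v.adicCompletion K))]
    [∀ v : HeightOneSpectrum (𝓞 K), LocallyCompactSpace (GL (Fin n) (v.adicCompletion K))]
    {π : ContRepresentation ℂ (AdelicGroupData.gl n K).Adelic H} (hu : π.IsUnitary)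
    (hc : π.IsStronglyContinuous)
    (ν : Measure (AdelicGroupData.gl n K).Adelic) [ν.IsHaarMeasure]
    (μ : ∀ v : S, Measure (GL (Fin n) ((v : HeightOneSpectrum (𝓞 K)).adicCompletion K)))
    [∀ v, (μ v).IsHaarMeasure]
    (μ' : Measure (GLn.trivialAt n K S)) [μ'.IsHaarMeasure]
    {κ : ℝ≥0} (hκ : Measure.map (GLn.placesSplitting n K S).symm ν = κ • (Measure.pi μ).prod μ')
    (huP : (π.restrict (GLn.placesSplitting n K S).toMulEquiv.toMonoidHom).IsUnitary)
    (hcP : (π.restrict (GLn.placesSplitting n K S).toMulEquiv.toMonoidHom).IsStronglyContinuous)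
    [IsFiniteMeasureOnCompacts ((Measure.pi μ).prod μ')]
    (Φ : C_c((AdelicGroupData.gl n K).Adelic, ℂ))
    (ΦP : C_c(GLn.LocalPi n K S × GLn.trivialAt n K S, ℂ))
    (hΦP : ∀ p, ΦP p = Φ (GLn.placesSplitting n K S p)) :
    π.integratedOperator hu hc ν Φ =
      (κ : ℂ) • (π.restrict (GLn.placesSplitting n K S).toMulEquiv.toMonoidHom).integratedOperator huP hcP
        ((Measure.pi μ).prod μ') ΦP := by
  haveI : T2Space (AdelicGroupData.gl n K).Adelic := t2Space_gl n K
  haveI : BorelSpace (GLn.trivialAt n K S) := Subtype.borelSpace _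
  haveI : SecondCountableTopology (GLn.trivialAt n K S) := TopologicalSpace.Subtype.secondCountableTopology _
  haveI : BorelSpace (GLn.LocalPi n K S) := Pi.borelSpace
  haveI : BorelSpace (GLn.LocalPi n K S × GLn.trivialAt n K S) := Prod.borelSpace
  ext w
  simp only [FunLike.coe_smul, Pi.smul_apply, ContRepresentation.integratedOperator_apply]
  -- change of variables along the splitting
  set e := (GLn.placesSplitting n K S).symm with he
  set em : (AdelicGroupData.gl n K).Adelic ≃ᵐ GLn.LocalPi n K S × GLn.trivialAt n K S :=
    e.toHomeomorph.toMeasurableEquiv with hem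
  have hem' : (em : _ → _) = e := rfl
  have h1 : ∫ g, Φ g • π g w ∂ν = ∫ p, Φ (e.symm p) • π (e.symm p) w ∂(Measure.map e ν) := by
    rw [← hem', integral_map_equiv]
    simp only [hem', ContinuousMulEquiv.symm_apply_apply]
  rw [h1, hκ, integral_smul_nnreal_measure, NNReal.smul_def, ← Complex.coe_smul]
  congr 1
  refine integral_congr_ae (Eventually.of_forall fun p => ?_)
  change Φ (e.symm p) • π (e.symm p) w =
    ΦP p • (π.restrict (GLn.placesSplitting n K S).toMulEquiv.toMonoidHom) p w
  rw [hΦP]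
  rfl

/-- The product of the measures `⊗_v μ_v` and `μ'` (Haar measures on the second countable, locally
compact factors) is finite on compact sets. [folklore] -/
theorem isFiniteMeasureOnCompacts_pi_prod_placesSplitting
    [∀ v : HeightOneSpectrum (𝓞 K), MeasurableSpace (GL (Fin n) (v.adicCompletion K))]
    [∀ v : HeightOneSpectrum (𝓞 K), BorelSpace (GL (Fin n) (v.adicCompletion K))]
    [∀ v : HeightOneSpectrum (𝓞 K), SecondCountableTopology (GL (Fin n) (v.adicCompletion K))]
    [∀ v : HeightOneSpectrum (𝓞 K), LocallyCompactSpace (GL (Fin n) (v.adicCompletion K))]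
    (μ : ∀ v : S, Measure (GL (Fin n) ((v : HeightOneSpectrum (𝓞 K)).adicCompletion K)))
    [∀ v, (μ v).IsHaarMeasure]
    (μ' : Measure (GLn.trivialAt n K S)) [μ'.IsHaarMeasure] :
    IsFiniteMeasureOnCompacts ((Measure.pi μ).prod μ') := by
  haveI : T2Space (AdelicGroupData.gl n K).Adelic := t2Space_gl n K
  haveI : ∀ v : HeightOneSpectrum (𝓞 K), T2Space (GL (Fin n) (v.adicCompletion K)) := fun v =>
    T2Space.of_injective_continuous (f := GLn.toAdelic n K v) (GLn.toAdelic_injective)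
      (GLn.continuous_toAdelic n K v)
  haveI : BorelSpace (GLn.trivialAt n K S) := Subtype.borelSpace _
  haveI : SecondCountableTopology (GLn.trivialAt n K S) := TopologicalSpace.Subtype.secondCountableTopology _
  haveI : BorelSpace (GLn.LocalPi n K S) := Pi.borelSpace
  haveI : BorelSpace (GLn.LocalPi n K S × GLn.trivialAt n K S) := Prod.borelSpace
  haveI : LocallyCompactSpace (GLn.trivialAt n K S) :=
    (GLn.isClosed_trivialAt n K S).isClosedEmbedding_subtypeVal.locallyCompactSpace
  haveI : SigmaCompactSpace (GLn.trivialAt n K S) := sigmaCompactSpace_of_locallyCompact_secondCountable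
  haveI : ∀ v : S, SigmaCompactSpace (GL (Fin n) ((v : HeightOneSpectrum (𝓞 K)).adicCompletion K)) :=
    fun v => sigmaCompactSpace_of_locallyCompact_secondCountable
  haveI : SFinite μ' := inferInstance
  haveI : ∀ v : S, SigmaFinite (μ v) := fun v => inferInstance
  haveI : ((Measure.pi μ).prod μ').IsHaarMeasure := inferInstance
  infer_instance

/-- **`π_ν(Ξ ⊗ θ) = κ · π_P|_{G_S}(Ξ) ∘ π_P|_{G^S}(θ|_{G^S})`** (Gelbart (1975), (10.12)–(10.13):
`R(Φ_f) = R_S(f_S) ∘ τ(f)`; Bump (1997), Prop. 3.3.2). Let `π` be a unitary strongly continuous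
representation of `GL_n(𝔸_K)` on a Hilbert space, `ν`, `μ_v` (`v ∈ S`), `μ'` Haar measures on
`GL_n(𝔸_K)`, `GL_n(K_v)`, `G^S` with `(splitting⁻¹)_* ν = κ ((⊗_v μ_v) ⊗ μ')`
(`GLn.exists_map_placesSplitting_symm_eq_smul_prod`), `Ξ ∈ C_c(G_S)` and `θ` a continuous compactly
supported weight on `GL_n(𝔸_K)` with restriction `θc ∈ C_c(G^S)`. Then
`π_ν(Φ_{Ξ,θ}) = κ · π_P|_{G_S}(Ξ) ∘ π_P|_{G^S}(θc)`, `π_P = π ∘ splitting`.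
[cite: Gelbart1975, (10.12)–(10.13)] -/
theorem integratedOperator_placesTestFunction_eq_smul_comp
    [∀ v : HeightOneSpectrum (𝓞 K), MeasurableSpace (GL (Fin n) (v.adicCompletion K))]
    [∀ v : HeightOneSpectrum (𝓞 K), BorelSpace (GL (Fin n) (v.adicCompletion K))]
    [∀ v : HeightOneSpectrum (𝓞 K), SecondCountableTopology (GL (Fin n) (v.adicCompletion K))]
    [∀ v : HeightOneSpectrum (𝓞 K), LocallyCompactSpace (GL (Fin n) (v.adicCompletion K))]
    {π : ContRepresentation ℂ (AdelicGroupData.gl n K).Adelic H} (hu : π.IsUnitary)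
    (hc : π.IsStronglyContinuous)
    (ν : Measure (AdelicGroupData.gl n K).Adelic) [ν.IsHaarMeasure]
    (μ : ∀ v : S, Measure (GL (Fin n) ((v : HeightOneSpectrum (𝓞 K)).adicCompletion K)))
    [∀ v, (μ v).IsHaarMeasure]
    (μ' : Measure (GLn.trivialAt n K S)) [μ'.IsHaarMeasure]
    {κ : ℝ≥0} (hκ : Measure.map (GLn.placesSplitting n K S).symm ν = κ • (Measure.pi μ).prod μ')
    (hu₁ : ((π.restrict (GLn.placesSplitting n K S).toMulEquiv.toMonoidHom).restrict
      (MonoidHom.inl _ _)).IsUnitary)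
    (hc₁ : ((π.restrict (GLn.placesSplitting n K S).toMulEquiv.toMonoidHom).restrict
      (MonoidHom.inl _ _)).IsStronglyContinuous)
    (hu₂ : ((π.restrict (GLn.placesSplitting n K S).toMulEquiv.toMonoidHom).restrict
      (MonoidHom.inr _ _)).IsUnitary)
    (hc₂ : ((π.restrict (GLn.placesSplitting n K S).toMulEquiv.toMonoidHom).restrict
      (MonoidHom.inr _ _)).IsStronglyContinuous)
    (Ξ : C_c(GLn.LocalPi n K S, ℂ))
    {θ : (AdelicGroupData.gl n K).Adelic → ℂ} (hθ : Continuous θ) (hθs : HasCompactSupport θ)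
    (θc : C_c(GLn.trivialAt n K S, ℂ)) (hθc : ∀ h, θc h = θ (h : (AdelicGroupData.gl n K).Adelic)) :
    π.integratedOperator hu hc ν (GLn.placesTestFunctionCc Ξ.continuous Ξ.hasCompactSupport hθ hθs) =
      (κ : ℂ) • (((π.restrict (GLn.placesSplitting n K S).toMulEquiv.toMonoidHom).restrict
          (MonoidHom.inl _ _)).integratedOperator hu₁ hc₁ (Measure.pi μ) Ξ ∘L
        ((π.restrict (GLn.placesSplitting n K S).toMulEquiv.toMonoidHom).restrict
          (MonoidHom.inr _ _)).integratedOperator hu₂ hc₂ μ' θc) := by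
  haveI : T2Space (AdelicGroupData.gl n K).Adelic := t2Space_gl n K
  haveI : ∀ v : HeightOneSpectrum (𝓞 K), T2Space (GL (Fin n) (v.adicCompletion K)) := fun v =>
    T2Space.of_injective_continuous (f := GLn.toAdelic n K v) (GLn.toAdelic_injective)
      (GLn.continuous_toAdelic n K v)
  haveI : BorelSpace (GLn.trivialAt n K S) := Subtype.borelSpace _
  haveI : SecondCountableTopology (GLn.trivialAt n K S) := TopologicalSpace.Subtype.secondCountableTopology _
  haveI : BorelSpace (GLn.LocalPi n K S) := Pi.borelSpace
  haveI : BorelSpace (GLn.LocalPi n K S × GLn.trivialAt n K S) := Prod.borelSpace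
  haveI : LocallyCompactSpace (GLn.trivialAt n K S) :=
    (GLn.isClosed_trivialAt n K S).isClosedEmbedding_subtypeVal.locallyCompactSpace
  haveI : SigmaCompactSpace (GLn.trivialAt n K S) := sigmaCompactSpace_of_locallyCompact_secondCountable
  haveI : ∀ v : S, SigmaCompactSpace (GL (Fin n) ((v : HeightOneSpectrum (𝓞 K)).adicCompletion K)) :=
    fun v => sigmaCompactSpace_of_locallyCompact_secondCountable
  haveI : SFinite μ' := inferInstance
  haveI : ∀ v : S, SigmaFinite (μ v) := fun v => inferInstance
  haveI : IsFiniteMeasureOnCompacts ((Measure.pi μ).prod μ') :=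
    isFiniteMeasureOnCompacts_pi_prod_placesSplitting μ μ'
  -- unitarity and strong continuity of `π ∘ splitting`
  have huP : (π.restrict (GLn.placesSplitting n K S).toMulEquiv.toMonoidHom).IsUnitary := hu.restrict _
  have hcP : (π.restrict (GLn.placesSplitting n K S).toMulEquiv.toMonoidHom).IsStronglyContinuous :=
    hc.restrict _ (GLn.placesSplitting n K S).continuous
  -- the test function on the product group, a pure tensor
  let ΦP : C_c(GLn.LocalPi n K S × GLn.trivialAt n K S, ℂ) :=
    ⟨⟨fun p => GLn.placesTestFunction S Ξ θ (GLn.placesSplitting n K S p),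
      (GLn.continuous_placesTestFunction Ξ.continuous hθ).comp (GLn.placesSplitting n K S).continuous⟩,
      (GLn.hasCompactSupport_placesTestFunction Ξ.hasCompactSupport hθs).comp_homeomorph
        (GLn.placesSplitting n K S).toHomeomorph⟩
  have hΦP : ∀ p, ΦP p = GLn.placesTestFunctionCc Ξ.continuous Ξ.hasCompactSupport hθ hθs
      (GLn.placesSplitting n K S p) := fun p => rfl
  rw [integratedOperator_eq_smul_integratedOperator_placesSplitting hu hc ν μ μ' hκ huP hcP _ ΦP hΦP]
  congr 1
  refine ContRepresentation.integratedOperator_prod_eq_comp huP hcP (Measure.pi μ) μ' hu₁ hc₁ hu₂ hc₂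
    Ξ θc ΦP fun a h => ?_
  change GLn.placesTestFunction S Ξ θ (GLn.placesSplitting n K S (a, h)) = Ξ a * θc h
  rw [GLn.placesTestFunction_placesSplitting, hθc, mul_comm]

omit [CompleteSpace H] in
/-- **The `G_S`-factor is the integrated operator along `ι_S`**: the restriction of
`π ∘ splitting` to the first factor is `π ∘ ι_S` (`splitting (a, 1) = ι_S a`), so their integrated
operators agree. [folklore] -/
theorem integratedOperator_restrict_placesSplitting_inl_eq
    [∀ v : HeightOneSpectrum (𝓞 K), MeasurableSpace (GL (Fin n) (v.adicCompletion K))]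
    [∀ v : HeightOneSpectrum (𝓞 K), BorelSpace (GL (Fin n) (v.adicCompletion K))]
    [∀ v : HeightOneSpectrum (𝓞 K), SecondCountableTopology (GL (Fin n) (v.adicCompletion K))]
    [CompleteSpace H]
    {π : ContRepresentation ℂ (AdelicGroupData.gl n K).Adelic H}
    (hu₁ : ((π.restrict (GLn.placesSplitting n K S).toMulEquiv.toMonoidHom).restrict
      (MonoidHom.inl _ _)).IsUnitary)
    (hc₁ : ((π.restrict (GLn.placesSplitting n K S).toMulEquiv.toMonoidHom).restrict
      (MonoidHom.inl _ _)).IsStronglyContinuous)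
    (hu' : (π.restrict (GLn.toAdelicPi n K S)).IsUnitary)
    (hc' : (π.restrict (GLn.toAdelicPi n K S)).IsStronglyContinuous)
    (μS : Measure (GLn.LocalPi n K S)) [IsFiniteMeasureOnCompacts μS] (Ξ : C_c(GLn.LocalPi n K S, ℂ)) :
    ((π.restrict (GLn.placesSplitting n K S).toMulEquiv.toMonoidHom).restrict
        (MonoidHom.inl _ _)).integratedOperator hu₁ hc₁ μS Ξ =
      (π.restrict (GLn.toAdelicPi n K S)).integratedOperator hu' hc' μS Ξ := by
  ext w
  rw [ContRepresentation.integratedOperator_apply, ContRepresentation.integratedOperator_apply]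
  refine integral_congr_ae (Eventually.of_forall fun a => ?_)
  change Ξ a • π (GLn.placesSplitting n K S ((MonoidHom.inl _ _) a)) w = Ξ a • π (GLn.toAdelicPi n K S a) w
  rw [GLn.placesSplitting_inl']

omit [CompleteSpace H] in
/-- Likewise the `G^S`-factor is the integrated operator of the restriction of `π` to the subgroup
`G^S` (`splitting (1, h) = h`). [folklore] -/
theorem integratedOperator_restrict_placesSplitting_inr_eq [CompleteSpace H]
    {π : ContRepresentation ℂ (AdelicGroupData.gl n K).Adelic H}
    (hu₂ : ((π.restrict (GLn.placesSplitting n K S).toMulEquiv.toMonoidHom).restrict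
      (MonoidHom.inr _ _)).IsUnitary)
    (hc₂ : ((π.restrict (GLn.placesSplitting n K S).toMulEquiv.toMonoidHom).restrict
      (MonoidHom.inr _ _)).IsStronglyContinuous)
    (hu' : (π.restrict (GLn.trivialAt n K S).subtype).IsUnitary)
    (hc' : (π.restrict (GLn.trivialAt n K S).subtype).IsStronglyContinuous)
    (μ' : Measure (GLn.trivialAt n K S)) [IsFiniteMeasureOnCompacts μ'] (θc : C_c(GLn.trivialAt n K S, ℂ)) :
    ((π.restrict (GLn.placesSplitting n K S).toMulEquiv.toMonoidHom).restrict
        (MonoidHom.inr _ _)).integratedOperator hu₂ hc₂ μ' θc =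
      (π.restrict (GLn.trivialAt n K S).subtype).integratedOperator hu' hc' μ' θc := by
  ext w
  rw [ContRepresentation.integratedOperator_apply, ContRepresentation.integratedOperator_apply]
  refine integral_congr_ae (Eventually.of_forall fun h => ?_)
  change θc h • π (GLn.placesSplitting n K S ((MonoidHom.inr _ _) h)) w =
    θc h • π ((GLn.trivialAt n K S).subtype h) w
  rw [GLn.placesSplitting_inr', Subgroup.coe_subtype]

end Operators

/-! ### Non-vanishing of `R(Ξ ⊗ θ)` for `θ` concentrated at `1` -/

section Nonvanishing

variable {n : ℕ} {K : Type} [Field K] [NumberField K] {S : Finset (HeightOneSpectrum (𝓞 K))}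
  {H : Type*} [NormedAddCommGroup H] [InnerProductSpace ℂ H] [CompleteSpace H]

attribute [local instance] adelicBorel borelSpace_adelic locallyCompactSpace_adelic
  secondCountableTopology_gl_adelic

/-- **If `(π ∘ ι_S)(Ξ) ≠ 0` then `π_ν(Ξ ⊗ θ) ≠ 0` for all `θ ≥ 0` concentrated at `1`** (Gelbart
(1975), pp. 151–153: the operators `R(ξ_S ⊗ f)` do not all vanish on a constituent on which
`R_S(ξ_S) ≠ 0`; Deitmar–Echterhoff (2014), Lemma 6.2.2 for the approximate identity). Data: `π`
unitary strongly continuous on `GL_n(𝔸_K)`; Haar measures `ν`, `μ_v` (`v ∈ S`), `μ'` with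
`(splitting⁻¹)_* ν = κ ((⊗_v μ_v) ⊗ μ')`; `Ξ ∈ C_c(G_S)` with `(π ∘ ι_S)(Ξ) ≠ 0` (with respect to
`⊗_v μ_v`). Conclusion: there is a neighbourhood `N` of `1` in `GL_n(𝔸_K)` such that for every
continuous compactly supported `θ : GL_n(𝔸_K) → ℝ` with `θ ≥ 0`, `θ(1) > 0` and `supp θ ⊆ N`,
`π_ν(Φ_{Ξ,θ}) ≠ 0`. Proof: pick `w` with `y = (π ∘ ι_S)(Ξ) w ≠ 0`; by
`integratedOperator_placesTestFunction_eq_smul_comp` and the commutation of the two factors,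
`π_ν(Φ_{Ξ,θ}) w = κ π|_{G^S}(θ) y`, which is non-zero for `θ` supported in the neighbourhood of
`exists_nhds_integratedOperator_apply_ne_zero` (a closed one, so that `supp θ ⊆ N` forces
`tsupport θ ⊆ N`), as `∫_{G^S} θ dμ' > 0` (`θ(1) > 0`, Haar measure). [cite: Gelbart1975, §10 pp. 151–153] -/
theorem GLn.exists_nhds_integratedOperator_placesTestFunction_ne_zero
    [∀ v : HeightOneSpectrum (𝓞 K), MeasurableSpace (GL (Fin n) (v.adicCompletion K))]
    [∀ v : HeightOneSpectrum (𝓞 K), BorelSpace (GL (Fin n) (v.adicCompletion K))]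
    [∀ v : HeightOneSpectrum (𝓞 K), SecondCountableTopology (GL (Fin n) (v.adicCompletion K))]
    [∀ v : HeightOneSpectrum (𝓞 K), LocallyCompactSpace (GL (Fin n) (v.adicCompletion K))]
    {π : ContRepresentation ℂ (AdelicGroupData.gl n K).Adelic H} (hu : π.IsUnitary)
    (hc : π.IsStronglyContinuous)
    (ν : Measure (AdelicGroupData.gl n K).Adelic) [ν.IsHaarMeasure]
    (μ : ∀ v : S, Measure (GL (Fin n) ((v : HeightOneSpectrum (𝓞 K)).adicCompletion K)))
    [∀ v, (μ v).IsHaarMeasure]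
    (μ' : Measure (GLn.trivialAt n K S)) [μ'.IsHaarMeasure]
    {κ : ℝ≥0} (hκ0 : 0 < κ) (hκ : Measure.map (GLn.placesSplitting n K S).symm ν = κ • (Measure.pi μ).prod μ')
    (hu' : (π.restrict (GLn.toAdelicPi n K S)).IsUnitary)
    (hc' : (π.restrict (GLn.toAdelicPi n K S)).IsStronglyContinuous)
    [IsFiniteMeasureOnCompacts (Measure.pi μ)]
    (Ξ : C_c(GLn.LocalPi n K S, ℂ))
    (hΞ : (π.restrict (GLn.toAdelicPi n K S)).integratedOperator hu' hc' (Measure.pi μ) Ξ ≠ 0) :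
    ∃ N ∈ 𝓝 (1 : (AdelicGroupData.gl n K).Adelic),
      ∀ (θ : (AdelicGroupData.gl n K).Adelic → ℝ) (hθ : Continuous θ) (hθs : HasCompactSupport θ),
        0 ≤ θ → 0 < θ 1 → Function.support θ ⊆ N →
        π.integratedOperator hu hc ν
          (GLn.placesTestFunctionCc Ξ.continuous Ξ.hasCompactSupport
            (Complex.continuous_ofReal.comp hθ) (hθs.comp_left Complex.ofReal_zero)) ≠ 0 := by
  haveI : T2Space (AdelicGroupData.gl n K).Adelic := t2Space_gl n K
  haveI : ∀ v : HeightOneSpectrum (𝓞 K), T2Space (GL (Fin n) (v.adicCompletion K)) := fun v =>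
    T2Space.of_injective_continuous (f := GLn.toAdelic n K v) (GLn.toAdelic_injective)
      (GLn.continuous_toAdelic n K v)
  haveI : BorelSpace (GLn.trivialAt n K S) := Subtype.borelSpace _
  haveI : SecondCountableTopology (GLn.trivialAt n K S) := TopologicalSpace.Subtype.secondCountableTopology _
  haveI : BorelSpace (GLn.LocalPi n K S) := Pi.borelSpace
  haveI : LocallyCompactSpace (GLn.trivialAt n K S) :=
    (GLn.isClosed_trivialAt n K S).isClosedEmbedding_subtypeVal.locallyCompactSpace
  -- the factors of `π ∘ splitting`
  set πP := π.restrict (GLn.placesSplitting n K S).toMulEquiv.toMonoidHom with hπP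
  have huP : πP.IsUnitary := hu.restrict _
  have hcP : πP.IsStronglyContinuous := hc.restrict _ (GLn.placesSplitting n K S).continuous
  have hu₁ : (πP.restrict (MonoidHom.inl _ _)).IsUnitary := huP.restrict _
  have hc₁ : (πP.restrict (MonoidHom.inl _ _)).IsStronglyContinuous :=
    hcP.restrict _ (continuous_id.prodMk continuous_const)
  have hu₂ : (πP.restrict (MonoidHom.inr _ _)).IsUnitary := huP.restrict _
  have hc₂ : (πP.restrict (MonoidHom.inr _ _)).IsStronglyContinuous :=
    hcP.restrict _ (continuous_const.prodMk continuous_id)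
  -- a vector surviving `(π ∘ ι_S)(Ξ)`
  obtain ⟨w, hw⟩ : ∃ w, (π.restrict (GLn.toAdelicPi n K S)).integratedOperator hu' hc' (Measure.pi μ) Ξ w ≠ 0 := by
    by_contra h
    push Not at h
    exact hΞ (ContinuousLinearMap.ext h)
  set y := (π.restrict (GLn.toAdelicPi n K S)).integratedOperator hu' hc' (Measure.pi μ) Ξ w with hy
  -- Dirac estimate for `π|_{G^S}` at `y`
  obtain ⟨U, hU, hUy⟩ := ContRepresentation.exists_nhds_integratedOperator_apply_ne_zero hu₂ hc₂ μ' hw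
  -- a closed neighbourhood of `1` in `GL_n(𝔸_K)` whose trace on `G^S` lies in `U`
  have hU' : U ∈ Filter.comap (Subtype.val : GLn.trivialAt n K S → (AdelicGroupData.gl n K).Adelic) (𝓝 1) := by
    rw [← nhds_subtype_eq_comap]
    exact hU
  obtain ⟨V, hV, hVU⟩ := Filter.mem_comap.1 hU'
  obtain ⟨N, ⟨hN, hNc⟩, hNV⟩ := (closed_nhds_basis (1 : (AdelicGroupData.gl n K).Adelic)).mem_iff.1 hV
  refine ⟨N, hN, fun θ hθ hθs hθ0 hθ1 hθN h0 => ?_⟩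
  -- the restriction of `θ` to `G^S`
  have hθcs : HasCompactSupport fun h : GLn.trivialAt n K S => (θ (h : (AdelicGroupData.gl n K).Adelic) : ℂ) := by
    refine HasCompactSupport.intro'
      ((GLn.isClosed_trivialAt n K S).isClosedEmbedding_subtypeVal.isCompact_preimage hθs.isCompact)
      ((isClosed_tsupport θ).preimage continuous_subtype_val) fun h hh => ?_
    rw [Set.mem_preimage] at hh
    rw [image_eq_zero_of_notMem_tsupport hh, Complex.ofReal_zero]
  let θc : C_c(GLn.trivialAt n K S, ℂ) :=
    ⟨⟨fun h => (θ (h : (AdelicGroupData.gl n K).Adelic) : ℂ),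
      Complex.continuous_ofReal.comp (hθ.comp continuous_subtype_val)⟩, hθcs⟩
  have hθc : ∀ h, θc h = ((θ (h : (AdelicGroupData.gl n K).Adelic) : ℂ)) := fun h => rfl
  -- `π_ν(Φ) = κ · π₁(Ξ) ∘ π₂(θc) = κ · π₂(θc) ∘ π₁(Ξ)`
  have hfac := integratedOperator_placesTestFunction_eq_smul_comp hu hc ν μ μ' hκ hu₁ hc₁ hu₂ hc₂ Ξ
    (Complex.continuous_ofReal.comp hθ) (hθs.comp_left Complex.ofReal_zero) θc hθc
  have hcomm := ContRepresentation.integratedOperator_restrict_inl_comm hu₁ hc₁ hu₂ hc₂ (Measure.pi μ) μ' Ξ θc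
  have h1 : (πP.restrict (MonoidHom.inl _ _)).integratedOperator hu₁ hc₁ (Measure.pi μ) Ξ w = y := by
    rw [hy, integratedOperator_restrict_placesSplitting_inl_eq hu₁ hc₁ hu' hc']
  -- evaluate at `w`
  have hw0 : π.integratedOperator hu hc ν
      (GLn.placesTestFunctionCc Ξ.continuous Ξ.hasCompactSupport (Complex.continuous_ofReal.comp hθ)
        (hθs.comp_left Complex.ofReal_zero)) w =
      (κ : ℂ) • (πP.restrict (MonoidHom.inr _ _)).integratedOperator hu₂ hc₂ μ' θc y := by
    rw [hfac, hcomm, FunLike.coe_smul, Pi.smul_apply, ContinuousLinearMap.comp_apply, h1]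
  rw [h0, FunLike.coe_zero, Pi.zero_apply] at hw0
  have hκ' : (κ : ℂ) ≠ 0 := by exact_mod_cast hκ0.ne'
  refine hUy θc (fun h => ⟨?_, ?_⟩) ?_ ?_ ((smul_eq_zero.1 hw0.symm).resolve_left hκ')
  · change 0 ≤ ((θ (h : (AdelicGroupData.gl n K).Adelic) : ℂ)).re
    rw [Complex.ofReal_re]
    exact hθ0 _
  · change ((θ (h : (AdelicGroupData.gl n K).Adelic) : ℂ)).im = 0
    exact Complex.ofReal_im _
  · -- `tsupport θc ⊆ val⁻¹(tsupport θ) ⊆ val⁻¹(N) ⊆ val⁻¹(V) ⊆ U`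
    intro h hh
    refine hVU (Set.mem_preimage.2 (hNV ?_))
    have hsupp : tsupport θ ⊆ N := closure_minimal hθN hNc
    refine hsupp ?_
    have : tsupport (θc : GLn.trivialAt n K S → ℂ) ⊆
        Subtype.val ⁻¹' tsupport θ := by
      refine closure_minimal (fun k hk => ?_) ((isClosed_tsupport θ).preimage continuous_subtype_val)
      rw [Set.mem_preimage]
      refine subset_tsupport _ ?_
      rw [Function.mem_support] at hk ⊢
      intro h0'
      exact hk (by change ((θ (k : (AdelicGroupData.gl n K).Adelic) : ℂ)) = 0; rw [h0', Complex.ofReal_zero])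
    exact this hh
  · -- `∫ θ dμ' > 0`: `θ ≥ 0` continuous with `θ(1) > 0`, `μ'` a Haar measure
    change 0 < ∫ h, ((θ (h : (AdelicGroupData.gl n K).Adelic) : ℂ)).re ∂μ'
    simp only [Complex.ofReal_re]
    have hcont : Continuous fun h : GLn.trivialAt n K S => θ (h : (AdelicGroupData.gl n K).Adelic) :=
      hθ.comp continuous_subtype_val
    have hcs : HasCompactSupport fun h : GLn.trivialAt n K S => θ (h : (AdelicGroupData.gl n K).Adelic) := by
      refine HasCompactSupport.intro'
        ((GLn.isClosed_trivialAt n K S).isClosedEmbedding_subtypeVal.isCompact_preimage hθs.isCompact)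
        ((isClosed_tsupport θ).preimage continuous_subtype_val) fun h hh => ?_
      rw [Set.mem_preimage] at hh
      exact image_eq_zero_of_notMem_tsupport hh
    rw [integral_pos_iff_support_of_nonneg
      (f := fun h : GLn.trivialAt n K S => θ (h : (AdelicGroupData.gl n K).Adelic))
      (fun h => hθ0 _) (hcont.integrable_of_hasCompactSupport hcs)]
    have hopen : IsOpen (Function.support fun h : GLn.trivialAt n K S => θ (h : (AdelicGroupData.gl n K).Adelic)) :=
      isOpen_ne_fun hcont continuous_const
    refine hopen.measure_pos μ' ⟨1, ?_⟩
    rw [Function.mem_support, Subgroup.coe_one]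
    exact hθ1.ne'

end Nonvanishing

end Literature.NumberTheory.Automorphic
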